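import Summits.SmoothPoincare4.SmoothPoincare4.Theses.ConvexBisection
import Literature.Topology.FourManifolds.Gluing
import Literature.Topology.FourManifolds.ClosedBall
import Literature.Topology.FourManifolds.Handles
import Literature.Topology.FourManifolds.MazurDouble
import Literature.Topology.FourManifolds.MazurDoubleHolds
import Literature.Topology.FourManifolds.PlanarAchiralWords
import Literature.Topology.FourManifolds.PlanarAchiralWordsInvariants
import Literature.Topology.FourManifolds.PlanarShadowWalk
import Literature.Topology.FourManifolds.PlanarShadowDouble
import Literature.Topology.FourManifolds.PlanarLefschetzBody
import Literature.Topology.FourManifolds.PlanarLefschetzBodyFacts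
import Literature.Topology.FourManifolds.PlanarLefschetzBodyCounterexample
import Literature.Topology.FourManifolds.SphereSimplyConnected
import Literature.Geometry.Symplectic.PlanarContactBoundary
import Literature.Geometry.Symplectic.PlanarMonodromy
import Literature.Geometry.Symplectic.PlanarSteinDictionary
import Literature.Geometry.Symplectic.PlanarHomologySphereFillings
import Summits.SmoothPoincare4.SmoothPoincare4.Theorems.ContractibleTwistedDoubleStandard.Negative.DoubleBisection
import Summits.SmoothPoincare4.SmoothPoincare4.Theorems.ConvexBisectionPlanarBisectionRigidityStubPlanarSeamTransfer
import Summits.SmoothPoincare4.SmoothPoincare4.Theorems.ConvexBisectionPlanarAcyclicBisectionRigidityStubK4LiftDouble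
import Summits.SmoothPoincare4.SmoothPoincare4.Theorems.ConvexBisectionPlanarAcyclicBisectionRigidityStubWalkLowDouble
import Summits.SmoothPoincare4.SmoothPoincare4.Theorems.ConvexBisectionPlanarAcyclicBisectionRigidityHelperReachMon
import Summits.SmoothPoincare4.SmoothPoincare4.Theorems.ConvexBisectionPlanarAcyclicBisectionRigidityHelperReachNG
import Summits.SmoothPoincare4.SmoothPoincare4.Theorems.ConvexBisectionPlanarAcyclicBisectionRigidityHelperWalkLowLevel3
import Summits.SmoothPoincare4.SmoothPoincare4.Theorems.ConvexBisectionPlanarAcyclicBisectionRigidityHelperK4LiftThree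
import Summits.SmoothPoincare4.SmoothPoincare4.Theorems.ConvexBisectionPlanarAcyclicBisectionRigidityHelperDoubleBall
import Summits.SmoothPoincare4.SmoothPoincare4.Theorems.ConvexBisectionPlanarAcyclicBisectionRigidityHelperObaMazur
import Summits.SmoothPoincare4.SmoothPoincare4.Theorems.ConvexBisectionPlanarAcyclicBisectionRigidityHelperAbelianArcData
import Summits.SmoothPoincare4.SmoothPoincare4.Theorems.ConvexBisectionPlanarAcyclicBisectionRigidityHelperConnectedSeam
import Summits.SmoothPoincare4.SmoothPoincare4.Theorems.ConvexBisectionPlanarAcyclicBisectionRigidityHelperUnimodularTransfer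
import Summits.SmoothPoincare4.SmoothPoincare4.Theorems.ConvexBisectionPlanarAcyclicBisectionRigidityStubWalkThree
import HarnessLib

/-!
# Line `Sketch` (k4-axis-calculus) for crux `ConvexBisection.PlanarAcyclicBisectionRigidity`
(item stmt-SmoothPoincare4-15086, route `route-SmoothPoincare4-ConvexBisection`, rank 5)

Skeleton **v4.0** (continuation lead prover-line-stmt-SmoothPoincare4-15086-c4-0, 2026-08-17) of the
line picked in `Cruxes/PlanarAcyclicBisectionRigidity/PICKED.md`, over the registered word calculus
`Literature.Topology.FourManifolds.PlanarWords` (p83576) and its `F₂` shadow (p96431).  History: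
v1.0–v1.6 (lead -0: the LEVER `stub_shadowWalkK4` proved, lifts and low walks landed), v1.7–v2.1
(c1: REACH-SC, orbit invariants p115709), v2.2–v2.3 (c2: the `k ≤ 4` layer leaves crux 4 via Oba 2016
+ Mazur; Hantzsche at word level), v3.0–v3.1 (c3: the dictionary itemised into eleven named facts
over the thin vocabulary `IsPlanarLefschetzBody` / `IsPlanarWordManifold`; `stub_walk3` — the level-3
walk for every spelling — PROVED, p151437 over ten helper files).

THE CRUX.  For every Hausdorff second-countable `C^∞` 4-manifold `M ≃ₕ S⁴`: if `M = e₁(W₁) ∪ e₂(W₂)`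
for two smoothly embedded compact Stein domains meeting exactly along the images of their
boundaries, with the complex tangencies pushed forward to the same plane field on the seam, BOTH
HALVES ℚ-ACYCLIC in positive degrees, and the contact boundary of `(W₁, J₁)` PLANAR, then `M ≅ S⁴`.

THE RESHAPE v4.0 (why; lead c4).  Two minutes after v3.1 was registered the fact seat of Oba 2016
landed `Literature/Topology/FourManifolds/PlanarLefschetzBodyCounterexample.lean`, which REFUTES three
of the eleven conjuncts of v3.1's `stub_dictionaryFacts` (`not_planarLefschetzBody_length_of_acyclic`,
`not_planarLefschetzBody_unimodular_of_isZero_H1`,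
`not_planarWordManifold_normallyGenerates_of_simplyConnected`): the vocabulary
`IsLefschetzHandlebodyOver` pins the boundary open book of the base only up to boundary multitwists
(`IsPageSystem` says nothing near `∂P`), so `𝔻⁴` is a "planar Lefschetz body over `P₁` with no
letters" and `S⁴` a "planar word manifold of the empty word".  Stub 1 of v3.1 is therefore FALSE AS
RENDERED (`stub_dictionaryFacts_false`, §1c, kernel-checked) — by vocabulary junk, not by mathematics
— and no fact taking that vocabulary as a hypothesis can be trusted.  The composition never used the
vocabulary, only the SHAPES of the facts; v4.0 makes that explicit.  NEW STUB 1 `stub_dictionary`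
states the dictionary BY ITS USE, in the crux's own vocabulary and the registered word calculus only,
positing NO intermediate object: every planar ℚ-acyclic common-contact Stein bisection of a homotopy
4-sphere `M` READS as a homotopy-sphere word `(n; A, B)` — in-range curves, `n` letters a side,
equal monodromies, curves jointly normally generating `F_n`, and `H₁(W₁;ℤ) = 0 → Unimodular n A` —
such that along the whole `Reachable` orbit of its block form (once the word is integral) every
`TwistEq` state WRITES BACK as a planar contractible Stein double of `M` at the reached level and
every state with two simply connected blocks WRITES BACK as a contractible common-contact Stein
re-bisection of `M`.  This is Etnyre 2006 §2 + Wendl 2010 Thm 1 (both halves, closed up) +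
Gompf–Stipsicz §8.2 (readers, Hurwitz moves) + Etnyre–Fuller §2 (stabilisation) + Baykur 2006
Thm 5.1 + Loi–Piergallini/Akbulut–Ozbagci/Gay, COMPOSED; SPC4-implied like its predecessor; and
immune to the defect above.  The itemisation survives as a DERIVATION (§2, c3's proofs with the two
predicates abstracted): for ANY reading `(PB, PW)` of bodies and closed models satisfying the eleven
fact shapes — which for the thin vocabulary are VERBATIM the eleven landed facts (§2, `example`s by
`Iff.rfl`) — `DictionaryByUse` follows (`dictionary_of_facts`).  So an honest vocabulary (a binding
clause in `IsPageSystem`, the repair named by the counterexample's author) plus the eleven `_holds`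
closes Stub 1 through §2, and nothing else in the line moves.

THE LINE v4.0 (registered stubs: `stub_dictionary`, `stub_walkHighSC`, `stub_contractibleStandard`,
`stub_torsionSector`, `stub_factOba`; `stub_walk3` closed in v3.1; composition
`PlanarAcyclicBisectionRigidity_of`, kernel-checked, no `sorry` of its own).  READ (`stub_dictionary`)
a homotopy-sphere word `(n; A, B)`.  `n ≤ 3`: integral automatically (Hantzsche at word level,
landed), walk to an honest double at level `3` (`helper_walkLow_level3` / `stub_walk3`, landed), DOUBLE
write-back (Stub 1) and Oba + Mazur (`helper_obaMazur_double_standard`, landed; Mazur PROVED in tree)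
— NO route item and no conjecture on this path (v4.0 also drops v3.1's preliminary "both halves
contractible → crux 4" branch, which put crux 4 on the `k ≤ 4` path for nothing).  `n ≥ 4`: INTEGRAL →
REACH-SC (`stub_walkHighSC`) → honest double (level `3`: Oba–Mazur; other levels: crux 4 via
`double_standard_of_crux`) or two simply connected blocks (SC write-back → crux 4); TORSION →
`stub_torsionSector`.

DISPROOF USED.  `Cruxes/PlanarAcyclicBisectionRigidity/Disproof.lean` v3 (cdisprove-0, unchanged since
2026-08-16T12:21Z; no `-- Targets` on v2.x/v3.x stubs): §1 kill criterion (Stub 1 and the fact stub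
are published theorems / SPC4-implied, crux 4 / torsion / REACH-SC as before); §3 planarity and
`M ≃ₕ S⁴` load-bearing (both consumed by `stub_dictionary`); §L lever true, ball-only lever false
(p100409) — no ball exit is used.  `ledger negatives --problem SmoothPoincare4`: nothing re-used.
-/

noncomputable section

open scoped Manifold ContDiff Topology ContinuousMap
open Set Function
open Literature.Geometry.Symplectic Literature.AlgebraicTopology.SingularHomology CategoryTheory.Limits
open Literature.Topology.FourManifolds (BoundaryData IsDouble HasHandleDecomposition
  IsPlanarLefschetzBody IsPlanarWordManifold simplyConnectedSpace_euclideanSphere)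
open Literature.Topology.FourManifolds.PlanarWords
open Literature.Topology.FourManifolds.PlanarShadow (F₂ IsPos XYPairs startState IsBallState
  IsDoubleState InShadowNormalForm)

-- The namespace is prescribed by the crux protocol (`Summit.<P>.<Sub>.Cruxes.<Crux>.<Slug>` with
-- `P = Sub = SmoothPoincare4`), hence the duplicated component.
set_option linter.dupNamespace false
set_option linter.unusedVariables false

namespace Summit.SmoothPoincare4.SmoothPoincare4.Cruxes.PlanarAcyclicBisectionRigidity.Sketch

open Summit.SmoothPoincare4.SmoothPoincare4.Theses

/-- Local notation: the round 4-sphere with its Mathlib manifold structure. -/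
local notation "𝕊⁴" => (Metric.sphere (0 : EuclideanSpace ℝ (Fin 5)) 1)

/-- Local notation: the model space `ℝ⁴`. -/
local notation "E4" => EuclideanSpace ℝ (Fin 4)

/-! ## §1  The registered stubs (v4.0) -/

/-- **Stub 1 (v4.0) — THE DICTIONARY, STATED BY ITS USE** (replaces v3.1's `stub_dictionaryFacts`,
refuted as rendered, §1c).  For every planar ℚ-acyclic common-contact Stein bisection
`M = e₁(W₁) ∪ e₂(W₂)` of a homotopy 4-sphere (the crux hypotheses, unbundled): THERE IS a
homotopy-sphere word `(n; A, B)` of the planar curve calculus — in-range curves, `n` letters a side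
(`χ`-reader on the ℚ-acyclic halves), equal monodromies (two positive factorisations of the one
planar monodromy), curves jointly normally generating `F_n` (`π₁(M) = 1`), and the `H₁`-reader
`H₁(W₁; ℤ) = 0 → Unimodular n A` — read from `W₁ = X(P_n; A)`, `W₂ = X(P_n; B)`,
`M = X̂(P_n; A B̄ʳᵉᵛ)` (Etnyre 2006 §2: positively framed planar monodromy chart; Wendl 2010 Thm 1 for
both halves as fillings of the one planar contact seam, closed up page to page: Etnyre–Fuller 2006
Prop. 12, Baykur 2006 proof of Thm 5.1; Gompf–Stipsicz §8.1–8.2 for `χ`, `H₁`, `π₁` of `X(P; w)`),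
SUCH THAT, once the word is integral, along the whole `Reachable` orbit of its block form (rotation,
signed Hurwitz moves, global conjugation, planar (de)stabilisation re-read the same closed manifold:
Gompf–Stipsicz §8.2/§8.4, Etnyre–Fuller §2 p. 5): (ii) every reached block form `(n′; A′, B′)` with
letterwise equal twists WRITES BACK `M = D(X)` for a compact CONTRACTIBLE Stein domain
`X = X(P_{n′}; A′)` whose boundary complex tangencies are supported by a planar open book with
`n′ + 1` binding components (Baykur §5 / GS §8.4 for the double; Loi–Piergallini / Akbulut–Ozbagci +
Gay for the Stein structure and the Kas book; `π₁(D X) = π₁(X)`, `|A′| = n′` and Whitehead for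
contractibility); (iv) every reached block form both of whose blocks have curves normally generating
`F_{n′}` WRITES BACK a common-contact Stein re-bisection of `M` into two CONTRACTIBLE compact Stein
domains (Baykur 2006 Thm 5.1; the `π₁`/`χ` readers).  No intermediate object (Lefschetz body,
monodromy chart) is posited: the statement lives in the crux's vocabulary and the registered calculus
alone, so it is immune to the vocabulary defect that killed v3.1's itemised stub; §2 derives it from
the eleven itemised fact shapes over ANY honest reading.  Status: published theorems composed
(Literature debt: an honest `X(P; w)` vocabulary + the eleven `_holds`); SPC4-implied.
(Wendl arXiv:0806.3193 Thm 1; Baykur arXiv:math/0601396 Thm 5.1; Gompf–Stipsicz 1999 §8.2.) -/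
theorem stub_dictionary
    (M : Type) [TopologicalSpace M] [T2Space M] [SecondCountableTopology M] [ChartedSpace E4 M]
    [IsManifold (𝓡 4) ∞ M] (hM : M ≃ₕ 𝕊⁴)
    (W₁ : Type) [TopologicalSpace W₁] [ChartedSpace (EuclideanHalfSpace 4) W₁] [IsManifold (𝓡∂ 4) ∞ W₁]
    [CompactSpace W₁] (W₂ : Type) [TopologicalSpace W₂] [ChartedSpace (EuclideanHalfSpace 4) W₂]
    [IsManifold (𝓡∂ 4) ∞ W₂] [CompactSpace W₂] (J₁ : SteinStructure W₁) (J₂ : SteinStructure W₂)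
    (e₁ : W₁ → M) (e₂ : W₂ → M)
    (he₁ : Manifold.IsSmoothEmbedding (𝓡∂ 4) (𝓡 4) ∞ e₁)
    (he₂ : Manifold.IsSmoothEmbedding (𝓡∂ 4) (𝓡 4) ∞ e₂)
    (hcover : range e₁ ∪ range e₂ = univ)
    (hseam₁ : range e₁ ∩ range e₂ = e₁ '' (𝓡∂ 4).boundary W₁)
    (hseam₂ : range e₁ ∩ range e₂ = e₂ '' (𝓡∂ 4).boundary W₂)
    (hξ : ∀ w₁ w₂, e₁ w₁ = e₂ w₂ →
      Submodule.map (mfderiv (𝓡∂ 4) (𝓡 4) e₁ w₁).toLinearMap (contactPlane J₁.J w₁) =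
      Submodule.map (mfderiv (𝓡∂ 4) (𝓡 4) e₂ w₂).toLinearMap (contactPlane J₂.J w₂))
    (hac : ∀ k, 0 < k → IsZero (singularHomology ℚ ℚ W₁ k) ∧ IsZero (singularHomology ℚ ℚ W₂ k))
    (hplanar : PlanarContactBoundary J₁) :
    ∃ (n : ℕ) (A B : List PlanarCurve),
      (∀ c ∈ A ++ B, c.InRange n) ∧ A.length = n ∧ B.length = n ∧
      monodromy n (positiveWord A) = monodromy n (positiveWord B) ∧ NormallyGenerates n (A ++ B) ∧
      (IsZero (singularHomology ℤ ℤ W₁ 1) → Unimodular n A) ∧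
      ∀ (n' : ℕ) (A' B' : List PlanarCurve), IsIntegralSphereWord n A B →
        Reachable (n, blockForm A B) (n', blockForm A' B') →
        (TwistEq n' A' B' →
          ∃ (W : Type) (_ : TopologicalSpace W) (_ : T2Space W) (_ : SecondCountableTopology W)
            (_ : ChartedSpace (EuclideanHalfSpace 4) W) (_ : IsManifold (𝓡∂ 4) ∞ W) (_ : CompactSpace W)
            (_ : ContractibleSpace W) (J : SteinStructure W) (b : BoundaryData (𝓡∂ 4) W (𝓡 3))
            (ob : OpenBook b.carrier),
            ob.IsPlanar ∧ ob.k = n' + 1 ∧ ob.Supports (boundaryPlaneField J.J b) ∧ IsDouble b (𝓡 4) M) ∧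
        (NormallyGenerates n' A' ∧ NormallyGenerates n' B' →
          ∃ (V₁ : Type) (_ : TopologicalSpace V₁) (_ : ChartedSpace (EuclideanHalfSpace 4) V₁)
            (_ : IsManifold (𝓡∂ 4) ∞ V₁) (_ : CompactSpace V₁) (_ : ContractibleSpace V₁)
            (V₂ : Type) (_ : TopologicalSpace V₂) (_ : ChartedSpace (EuclideanHalfSpace 4) V₂)
            (_ : IsManifold (𝓡∂ 4) ∞ V₂) (_ : CompactSpace V₂) (_ : ContractibleSpace V₂)
            (K₁ : SteinStructure V₁) (K₂ : SteinStructure V₂) (f₁ : V₁ → M) (f₂ : V₂ → M),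
            Manifold.IsSmoothEmbedding (𝓡∂ 4) (𝓡 4) ∞ f₁ ∧ Manifold.IsSmoothEmbedding (𝓡∂ 4) (𝓡 4) ∞ f₂ ∧
            range f₁ ∪ range f₂ = univ ∧ range f₁ ∩ range f₂ = f₁ '' (𝓡∂ 4).boundary V₁ ∧
            range f₁ ∩ range f₂ = f₂ '' (𝓡∂ 4).boundary V₂ ∧
            (∀ v₁ v₂, f₁ v₁ = f₂ v₂ →
              Submodule.map (mfderiv (𝓡∂ 4) (𝓡 4) f₁ v₁).toLinearMap (contactPlane K₁.J v₁) =
              Submodule.map (mfderiv (𝓡∂ 4) (𝓡 4) f₂ v₂).toLinearMap (contactPlane K₂.J v₂))) := by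
  sorry

/-- **Stub 2 (v3.0) — THE LEVEL-3 WALK FOR EVERY SPELLING — PROVED (v3.1: the registered stub
`Theorems.PlanarAcyclicBisectionRigidity.Sketch.stub_walk3`, p151437, over p147613 p147802 p148649
p149319 p150448 p149487 p149391 p149409; in-house combinatorics).**  Every integral homotopy-sphere
word on three holes — in ANY spelling of its curves — walks (signed Hurwitz moves, rotations, global
conjugations, planar (de)stabilisations) to an honest double AT LEVEL `3`.  SPC4-independent,
decidable per instance. (Gompf–Stipsicz §8.2; K4AxesEvidence §1–§4.) -/
theorem stub_walk3 (A B : List PlanarCurve) (hw : IsIntegralSphereWord 3 A B) :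
    ∃ (A' B' : List PlanarCurve),
      Reachable (3, blockForm A B) (3, blockForm A' B') ∧ TwistEq 3 A' B' :=
  Summit.SmoothPoincare4.SmoothPoincare4.Theorems.PlanarAcyclicBisectionRigidity.Sketch.stub_walk3 A B hw

/-- **Stub 3 (v2.0) — THE WALK FOR `n ≥ 4` LETTERS (`k ≥ 5`): REACH-SC (conjecture exactly on the
perfect sector; size XL).**  Every integral homotopy-sphere word `(n; A, B)` with `n ≥ 4` walks
(signed Hurwitz moves, rotations, global conjugations, planar (de)stabilisations) to an honest
double (`TwistEq`) OR to a block word both of whose blocks are simply connected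
(`NormallyGenerates n′ A′ ∧ NormallyGenerates n′ B′`).  Holds by `Reachable.refl` on every word of
every census computed on this crux and its lineage (`k = 4`: 64 + 8 pairs; `k = 5`: 8 native pairs,
the reflection twins, GAP j017350: both blocks simply connected); has content only on the PERFECT
SECTOR (a block presenting a non-trivial perfect group), which is inhabited at BLOCK level at `k = 5`
(`helper_exists_perfectBlock`, p130571: `π₁(X_A) ≅ SL(2,5)`) while no perfect-sector SPHERE word is
known (`PerfectBlocksK5.md` v3: every re-factorisation of a perfect block's monodromy found in the
pools searched is Hurwitz-related to it).  NOT SPC4-implied (a move-rigid perfect-sector word inside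
`S⁴` refutes it); machine-attackable both ways.  (Wendl arXiv:0806.3193 Thm 1; KOU arXiv:1607.07661
Prop 2.3.) -/
theorem stub_walkHighSC (n : ℕ) (A B : List PlanarCurve) (hw : IsIntegralSphereWord n A B) (hn : 4 ≤ n) :
    ∃ (n' : ℕ) (A' B' : List PlanarCurve),
      Reachable (n, blockForm A B) (n', blockForm A' B') ∧
        (TwistEq n' A' B' ∨ (NormallyGenerates n' A' ∧ NormallyGenerates n' B')) := by
  sorry

/-- **Stub 4 (v2.0) — THE ABSORBING TARGET FOR `k ≥ 5`: the route's crux 4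
`ContractibleTwistedDoubleStandard`** (stmt-SmoothPoincare4-3546), VERBATIM (the route decl itself).
Closes when the item's proof lands (`exact ConvexBisection.ContractibleTwistedDoubleStandard_holds`).
It absorbs (a) the honest doubles of the walk at levels `n′ ≠ 3` (`planarSteinDouble_of_crux4`) and
(b) the simply-connected-blocks exit (`contractibleHalves_absorb`).  NOT on the path of the `k ≤ 4`
layer (v4.0: not even for contractible halves).  SPC4-implied; open (Gompf arXiv:1603.05090 Q2.2
sits inside). (Mazur 1961.) -/
theorem stub_contractibleStandard : ConvexBisection.ContractibleTwistedDoubleStandard := by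
  sorry

/-- **Stub 5 — RESIDUAL, THE TORSION SECTOR (open; size L–XL).**  The crux's data with the extra
hypothesis `H₁(W₁; ℤ) ≠ 0` — the torsion slice of crux `AcyclicBisectionRigidity` restricted to
planar seams (`torsionSector_of_acyclicRigidity`, §5; DELEGATE to stmt-SmoothPoincare4-10507).  Here
the halves are Stein rational balls with `H₁(W₁) ≅ H₁(W₂) = G ≠ 0`, the seam has `H₁ ≅ G ⊕ G`;
EMPTY at `k ≤ 4` (Hantzsche at word level, `helper_unimodular_of_sphereWord_le3`), INHABITED at
`k = 5` (seam `S³/Q₈`, the round `S⁴ = N₊(ℝP²) ∪ N₋(ℝP²)`).  SPC4-implied. (Ghiggini–Lisca–Stipsicz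
arXiv:math/0509714 §4.) -/
theorem stub_torsionSector
    (M : Type) [TopologicalSpace M] [T2Space M] [SecondCountableTopology M] [ChartedSpace E4 M]
    [IsManifold (𝓡 4) ∞ M] (hM : M ≃ₕ 𝕊⁴)
    (W₁ : Type) [TopologicalSpace W₁] [ChartedSpace (EuclideanHalfSpace 4) W₁] [IsManifold (𝓡∂ 4) ∞ W₁]
    [CompactSpace W₁] (W₂ : Type) [TopologicalSpace W₂] [ChartedSpace (EuclideanHalfSpace 4) W₂]
    [IsManifold (𝓡∂ 4) ∞ W₂] [CompactSpace W₂] (J₁ : SteinStructure W₁) (J₂ : SteinStructure W₂)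
    (e₁ : W₁ → M) (e₂ : W₂ → M)
    (he₁ : Manifold.IsSmoothEmbedding (𝓡∂ 4) (𝓡 4) ∞ e₁)
    (he₂ : Manifold.IsSmoothEmbedding (𝓡∂ 4) (𝓡 4) ∞ e₂)
    (hcover : range e₁ ∪ range e₂ = univ)
    (hseam₁ : range e₁ ∩ range e₂ = e₁ '' (𝓡∂ 4).boundary W₁)
    (hseam₂ : range e₁ ∩ range e₂ = e₂ '' (𝓡∂ 4).boundary W₂)
    (hξ : ∀ w₁ w₂, e₁ w₁ = e₂ w₂ →
      Submodule.map (mfderiv (𝓡∂ 4) (𝓡 4) e₁ w₁).toLinearMap (contactPlane J₁.J w₁) =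
      Submodule.map (mfderiv (𝓡∂ 4) (𝓡 4) e₂ w₂).toLinearMap (contactPlane J₂.J w₂))
    (hplanar : PlanarContactBoundary J₁)
    (hac : ∀ k, 0 < k → IsZero (singularHomology ℚ ℚ W₁ k) ∧ IsZero (singularHomology ℚ ℚ W₂ k))
    (htor : ¬ IsZero (singularHomology ℤ ℤ W₁ 1)) :
    Nonempty (M ≃ₘ⟮𝓡 4, 𝓡 4⟯ 𝕊⁴) := by
  sorry

/-- **Stub 6 (v2.2) — the named fact Oba 2016 Thm 1.1**
(`Literature.Geometry.Symplectic.Oba2016_steinFilling_fourHoledSphere`, p138262): a published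
theorem, not an open problem, stated over `OpenBook` / `Supports` / `HasHandleDecomposition` (NOT over
the defective Lefschetz-body vocabulary); the tree has REDUCED it to "some handle decomposition with
at most one 1-handle and none of index ≥ 3"
(`Oba2016_steinFilling_fourHoledSphere_of_oneHandle_le_one`, `PlanarHomologySphereFillingsProofs.lean`)
and further to Wendl over `PALF` + Kas' count + Kas' incidences
(`Oba2016_steinFilling_fourHoledSphere_of_wendl_of_kas_of_kasIncidence`, `…Cancel.lean`).
SPC4-independent and TRUE. (Oba arXiv:1407.5257 Thm 1.1.) -/
theorem stub_factOba : Oba2016_steinFilling_fourHoledSphere := by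
  sorry

/-! ## §1b  Landed helpers (wrappers kept for the record; the composition calls the tree decls) -/

/-- **GRAM TRANSFER OF UNIMODULARITY — PROVED (wave c3-1, `helper_unimodular_transfer`,
p143648).**  For two positive factorisations `A`, `B` of one mapping class on `n` holes, `n` letters
each: if the hole matrix of `A` is unimodular then so is that of `B`. [folklore] -/
theorem unimodular_transfer (n : ℕ) (A B : List PlanarCurve) (hin : ∀ c ∈ A ++ B, c.InRange n)
    (hA : A.length = n) (hB : B.length = n)
    (hmon : monodromy n (positiveWord A) = monodromy n (positiveWord B)) (huA : Unimodular n A) :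
    Unimodular n B :=
  Theorems.PlanarAcyclicBisectionRigidity.Sketch.helper_unimodular_transfer n A B hin hA hB hmon huA

/-- **The low walk re-cut to LEVEL 3** (landed p137315, wave c2-1): every integral homotopy-sphere
word with `n ≤ 2` letters reaches an honest double AT LEVEL `3`. [folklore] -/
theorem helper_walkLow_level3 (n : ℕ) (A B : List PlanarCurve) (hw : IsIntegralSphereWord n A B)
    (hn : n ≤ 2) :
    ∃ (A' B' : List PlanarCurve),
      Reachable (n, blockForm A B) (3, blockForm A' B') ∧ TwistEq 3 A' B' :=
  Theorems.PlanarAcyclicBisectionRigidity.Sketch.helper_walkLow_level3 n A B hw hn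

/-- **Hantzsche at word level** (landed p139527 over p139282): a homotopy-sphere word on `n ≤ 3`
holes has both hole matrices unimodular — the torsion sector is EMPTY at `k ≤ 4`. [folklore] -/
theorem helper_unimodular_of_sphereWord_le3 (n : ℕ) (hn : n ≤ 3) (A B : List PlanarCurve)
    (hin : ∀ c ∈ A ++ B, c.InRange n) (hA : A.length = n) (hB : B.length = n)
    (hmon : monodromy n (positiveWord A) = monodromy n (positiveWord B))
    (hng : NormallyGenerates n (A ++ B)) : Unimodular n A ∧ Unimodular n B :=
  Theorems.PlanarAcyclicBisectionRigidity.Sketch.helper_unimodular_of_sphereWord_le3 n hn A B hin hA hB hmon hng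

/-- **Oba + Mazur** (landed p138263): the double of a contractible compact Stein domain whose
boundary contact structure is supported by a planar open book with four binding components is
`S⁴` (Oba 2016 Thm 1.1 as the fact `stub_factOba`; Mazur 1961 PROVED in tree; the `D⁴` branch by
`helper_double_closedBall_sphere` p137754). [folklore] -/
theorem helper_obaMazur_double_standard (hO : Oba2016_steinFilling_fourHoledSphere)
    (W : Type) [TopologicalSpace W] [T2Space W] [SecondCountableTopology W]
    [ChartedSpace (EuclideanHalfSpace 4) W] [IsManifold (𝓡∂ 4) ∞ W] [CompactSpace W]
    [ContractibleSpace W] (S : SteinStructure W) (b : BoundaryData (𝓡∂ 4) W (𝓡 3))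
    (ob : OpenBook b.carrier) (hpl : ob.IsPlanar) (hk : ob.k = 4)
    (hsupp : ob.Supports (boundaryPlaneField S.J b))
    (P : Type) [TopologicalSpace P] [T2Space P] [SecondCountableTopology P]
    [ChartedSpace (EuclideanSpace ℝ (Fin 4)) P] [IsManifold (𝓡 4) ∞ P] (hD : IsDouble b (𝓡 4) P) :
    Nonempty (P ≃ₘ⟮𝓡 4, 𝓡 4⟯ Metric.sphere (0 : EuclideanSpace ℝ (Fin 5)) 1) :=
  Theorems.PlanarAcyclicBisectionRigidity.Sketch.helper_obaMazur_double_standard hO W S b ob hpl hk hsupp P hD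

/-! ## §1c  Why v3.1's Stub 1 died (kernel-checked) and the v4.0 statement as a named shape -/

/-- **v3.1's `stub_dictionaryFacts` is FALSE as rendered**: its fifth conjunct
`planarLefschetzBody_length_of_acyclic` is refuted in the tree
(`Literature.Topology.FourManifolds.not_planarLefschetzBody_length_of_acyclic`: `𝔻⁴` is a "planar
Lefschetz body over `P₁` with `0 ≠ 1` letters", the `IsPageSystem` clause of
`IsLefschetzHandlebodyOver` not pinning the boundary open book of the base); so are the sixth and the
seventh.  Recorded so that no continuation re-registers the itemised stub over that vocabulary.
[folklore] -/
theorem stub_dictionaryFacts_false :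
    ¬ (supportedPlanarMonodromy ∧ wendl_planarSteinBisection ∧ planarLefschetzBody_stein_supported ∧
      baykur_planarSteinBisection ∧ planarLefschetzBody_length_of_acyclic ∧
      planarLefschetzBody_unimodular_of_isZero_H1 ∧
      planarWordManifold_normallyGenerates_of_simplyConnected ∧ planarLefschetzBody_contractible ∧
      planarLefschetzBody_contractible_of_isDouble ∧ planarWordManifold_move_iff ∧
      planarWordManifold_isDouble_of_twistEq) :=
  fun h => Literature.Topology.FourManifolds.not_planarLefschetzBody_length_of_acyclic h.2.2.2.2.1

/-- **The v4.0 dictionary statement as a named proposition** (`DictionaryByUse`; VERBATIM the type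
of `stub_dictionary`, see `dictionaryByUse_of_stub`), so that §2 can conclude it. [folklore] -/
def DictionaryByUse : Prop :=
  ∀ (M : Type) [TopologicalSpace M] [T2Space M] [SecondCountableTopology M] [ChartedSpace E4 M]
    [IsManifold (𝓡 4) ∞ M] (hM : M ≃ₕ 𝕊⁴)
    (W₁ : Type) [TopologicalSpace W₁] [ChartedSpace (EuclideanHalfSpace 4) W₁] [IsManifold (𝓡∂ 4) ∞ W₁]
    [CompactSpace W₁] (W₂ : Type) [TopologicalSpace W₂] [ChartedSpace (EuclideanHalfSpace 4) W₂]
    [IsManifold (𝓡∂ 4) ∞ W₂] [CompactSpace W₂] (J₁ : SteinStructure W₁) (J₂ : SteinStructure W₂)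
    (e₁ : W₁ → M) (e₂ : W₂ → M)
    (he₁ : Manifold.IsSmoothEmbedding (𝓡∂ 4) (𝓡 4) ∞ e₁)
    (he₂ : Manifold.IsSmoothEmbedding (𝓡∂ 4) (𝓡 4) ∞ e₂)
    (hcover : range e₁ ∪ range e₂ = univ)
    (hseam₁ : range e₁ ∩ range e₂ = e₁ '' (𝓡∂ 4).boundary W₁)
    (hseam₂ : range e₁ ∩ range e₂ = e₂ '' (𝓡∂ 4).boundary W₂)
    (hξ : ∀ w₁ w₂, e₁ w₁ = e₂ w₂ →
      Submodule.map (mfderiv (𝓡∂ 4) (𝓡 4) e₁ w₁).toLinearMap (contactPlane J₁.J w₁) =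
      Submodule.map (mfderiv (𝓡∂ 4) (𝓡 4) e₂ w₂).toLinearMap (contactPlane J₂.J w₂))
    (hac : ∀ k, 0 < k → IsZero (singularHomology ℚ ℚ W₁ k) ∧ IsZero (singularHomology ℚ ℚ W₂ k))
    (hplanar : PlanarContactBoundary J₁),
    ∃ (n : ℕ) (A B : List PlanarCurve),
      (∀ c ∈ A ++ B, c.InRange n) ∧ A.length = n ∧ B.length = n ∧
      monodromy n (positiveWord A) = monodromy n (positiveWord B) ∧ NormallyGenerates n (A ++ B) ∧
      (IsZero (singularHomology ℤ ℤ W₁ 1) → Unimodular n A) ∧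
      ∀ (n' : ℕ) (A' B' : List PlanarCurve), IsIntegralSphereWord n A B →
        Reachable (n, blockForm A B) (n', blockForm A' B') →
        (TwistEq n' A' B' →
          ∃ (W : Type) (_ : TopologicalSpace W) (_ : T2Space W) (_ : SecondCountableTopology W)
            (_ : ChartedSpace (EuclideanHalfSpace 4) W) (_ : IsManifold (𝓡∂ 4) ∞ W) (_ : CompactSpace W)
            (_ : ContractibleSpace W) (J : SteinStructure W) (b : BoundaryData (𝓡∂ 4) W (𝓡 3))
            (ob : OpenBook b.carrier),
            ob.IsPlanar ∧ ob.k = n' + 1 ∧ ob.Supports (boundaryPlaneField J.J b) ∧ IsDouble b (𝓡 4) M) ∧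
        (NormallyGenerates n' A' ∧ NormallyGenerates n' B' →
          ∃ (V₁ : Type) (_ : TopologicalSpace V₁) (_ : ChartedSpace (EuclideanHalfSpace 4) V₁)
            (_ : IsManifold (𝓡∂ 4) ∞ V₁) (_ : CompactSpace V₁) (_ : ContractibleSpace V₁)
            (V₂ : Type) (_ : TopologicalSpace V₂) (_ : ChartedSpace (EuclideanHalfSpace 4) V₂)
            (_ : IsManifold (𝓡∂ 4) ∞ V₂) (_ : CompactSpace V₂) (_ : ContractibleSpace V₂)
            (K₁ : SteinStructure V₁) (K₂ : SteinStructure V₂) (f₁ : V₁ → M) (f₂ : V₂ → M),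
            Manifold.IsSmoothEmbedding (𝓡∂ 4) (𝓡 4) ∞ f₁ ∧ Manifold.IsSmoothEmbedding (𝓡∂ 4) (𝓡 4) ∞ f₂ ∧
            range f₁ ∪ range f₂ = univ ∧ range f₁ ∩ range f₂ = f₁ '' (𝓡∂ 4).boundary V₁ ∧
            range f₁ ∩ range f₂ = f₂ '' (𝓡∂ 4).boundary V₂ ∧
            (∀ v₁ v₂, f₁ v₁ = f₂ v₂ →
              Submodule.map (mfderiv (𝓡∂ 4) (𝓡 4) f₁ v₁).toLinearMap (contactPlane K₁.J v₁) =
              Submodule.map (mfderiv (𝓡∂ 4) (𝓡 4) f₂ v₂).toLinearMap (contactPlane K₂.J v₂)))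

/-- The registered stub proves the named proposition on the nose (their statements coincide).
[folklore] -/
theorem dictionaryByUse_of_stub : DictionaryByUse :=
  fun M _ _ _ _ _ hM W₁ _ _ _ _ W₂ _ _ _ _ J₁ J₂ e₁ e₂ he₁ he₂ hcover hseam₁ hseam₂ hξ hac hplanar =>
    stub_dictionary M hM W₁ W₂ J₁ J₂ e₁ e₂ he₁ he₂ hcover hseam₁ hseam₂ hξ hac hplanar

/-! ## §2  THE DICTIONARY BY USE, DERIVED FROM THE ELEVEN ITEMISED FACT SHAPES OVER ANY READING

The v3.0 itemisation (F-a, Wendl, Loi–Piergallini, Baykur, five readers, move invariance, the double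
of a block) is kept, with the two predicates "`X` is the planar Lefschetz body `X(P_n; w)`" and
"`M` is the planar word manifold `X̂(P_n; w)`" ABSTRACTED into variables `PB`, `PW` (a *reading*).
For the thin vocabulary of `PlanarLefschetzBody.lean` the shapes are verbatim the landed named
facts (the `example`s), three of which are refuted for THAT reading; for an honest reading they
are the printed theorems, and `dictionary_of_facts` shows they give `DictionaryByUse`. -/

section Derivation

/-- A READING of compact 4-manifolds with boundary as planar Lefschetz bodies: `PB X n w` is to
mean "`X` is `X(P_n; w)`". [folklore] -/
abbrev BodyReading : Type 1 :=
  ∀ (X : Type) [TopologicalSpace X] [ChartedSpace (EuclideanHalfSpace 4) X], ℕ → List Letter → Prop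

/-- A READING of closed 4-manifolds as planar word manifolds: `PW M n w` is to mean "`M` is
`X̂(P_n; w)`". [folklore] -/
abbrev WordReading : Type 1 :=
  ∀ (M : Type) [TopologicalSpace M] [ChartedSpace E4 M], ℕ → List Letter → Prop

variable (PB : BodyReading) (PW : WordReading)

/-- Shape F-WB (Wendl 2010 Thm 1 for both halves of a Stein bisection along a planar seam, closed
up), over the reading `(PB, PW)`; for the thin vocabulary this is `wendl_planarSteinBisection`
verbatim. [cite: Wendl2010, Thm. 1] -/
def ShapeWendl : Prop :=
  ∀ (M : Type) [TopologicalSpace M] [T2Space M] [SecondCountableTopology M] [ChartedSpace (EuclideanSpace ℝ (Fin 4)) M]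
    [IsManifold (𝓡 4) ∞ M]
    (W₁ : Type) [TopologicalSpace W₁] [ChartedSpace (EuclideanHalfSpace 4) W₁] [IsManifold (𝓡∂ 4) ∞ W₁]
    [CompactSpace W₁] (W₂ : Type) [TopologicalSpace W₂] [ChartedSpace (EuclideanHalfSpace 4) W₂]
    [IsManifold (𝓡∂ 4) ∞ W₂] [CompactSpace W₂] (J₁ : SteinStructure W₁) (J₂ : SteinStructure W₂)
    (e₁ : W₁ → M) (e₂ : W₂ → M),
    Manifold.IsSmoothEmbedding (𝓡∂ 4) (𝓡 4) ∞ e₁ → Manifold.IsSmoothEmbedding (𝓡∂ 4) (𝓡 4) ∞ e₂ →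
    range e₁ ∪ range e₂ = univ → range e₁ ∩ range e₂ = e₁ '' (𝓡∂ 4).boundary W₁ →
    range e₁ ∩ range e₂ = e₂ '' (𝓡∂ 4).boundary W₂ →
    (∀ w₁ w₂, e₁ w₁ = e₂ w₂ →
      Submodule.map (mfderiv (𝓡∂ 4) (𝓡 4) e₁ w₁).toLinearMap (contactPlane J₁.J w₁) =
      Submodule.map (mfderiv (𝓡∂ 4) (𝓡 4) e₂ w₂).toLinearMap (contactPlane J₂.J w₂)) →
    ∀ (b₁ : BoundaryData (𝓡∂ 4) W₁ (𝓡 3)) (K : OpenBook b₁.carrier)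
      (α : Literature.Geometry.Kaehler.MForm (𝓡 3) b₁.carrier ℝ 1) (n : ℕ) (φ : ArcData n),
      K.IsGirouxForm (boundaryPlaneField J₁.J b₁) α → IsPositivelyFramed K α →
      K.HasPlanarMonodromy n φ →
      ∃ A B : List PlanarCurve, (∀ c ∈ A ++ B, c.InRange n) ∧
        monodromy n (positiveWord A) = φ ∧ monodromy n (positiveWord B) = φ ∧
        PB W₁ n (positiveWord A) ∧ PB W₂ n (positiveWord B) ∧ PW M n (blockForm A B)

/-- Shape F-c (Loi–Piergallini / Akbulut–Ozbagci + Gay: PALF ⇒ Stein with the Kas book supporting),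
over `PB`; for the thin vocabulary this is `planarLefschetzBody_stein_supported` verbatim.
[cite: LoiPiergallini2001, Thm. 1] -/
def ShapeSteinSupported : Prop :=
  ∀ (X : Type) [TopologicalSpace X] [T2Space X] [SecondCountableTopology X]
    [ChartedSpace (EuclideanHalfSpace 4) X] [IsManifold (𝓡∂ 4) ∞ X] [CompactSpace X]
    (n : ℕ) (A : List PlanarCurve), (∀ c ∈ A, c.a ≤ c.b ∧ c.b < n) →
    PB X n (positiveWord A) →
    ∀ b : BoundaryData (𝓡∂ 4) X (𝓡 3), ∃ (S : SteinStructure X) (ob : OpenBook b.carrier),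
      ob.IsPlanar ∧ ob.k = n + 1 ∧ ob.Supports (boundaryPlaneField S.J b)

/-- Shape F-S (Baykur 2006 Thm 5.1: the closed model of a block word is a Stein bisection of its
two bodies), over `(PB, PW)`; for the thin vocabulary this is `baykur_planarSteinBisection` verbatim.
[cite: Baykur2006, Thm. 5.1 (proof)] -/
def ShapeBaykur : Prop :=
  ∀ (M : Type) [TopologicalSpace M] [T2Space M] [SecondCountableTopology M] [ChartedSpace (EuclideanSpace ℝ (Fin 4)) M]
    [IsManifold (𝓡 4) ∞ M] (n : ℕ) (A B : List PlanarCurve), (∀ c ∈ A ++ B, c.a ≤ c.b ∧ c.b < n) →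
    monodromy n (positiveWord A) = monodromy n (positiveWord B) →
    PW M n (blockForm A B) →
    ∃ (V₁ : Type) (_ : TopologicalSpace V₁) (_ : ChartedSpace (EuclideanHalfSpace 4) V₁)
      (_ : IsManifold (𝓡∂ 4) ∞ V₁) (_ : CompactSpace V₁)
      (V₂ : Type) (_ : TopologicalSpace V₂) (_ : ChartedSpace (EuclideanHalfSpace 4) V₂)
      (_ : IsManifold (𝓡∂ 4) ∞ V₂) (_ : CompactSpace V₂)
      (K₁ : SteinStructure V₁) (K₂ : SteinStructure V₂) (f₁ : V₁ → M) (f₂ : V₂ → M),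
      Manifold.IsSmoothEmbedding (𝓡∂ 4) (𝓡 4) ∞ f₁ ∧ Manifold.IsSmoothEmbedding (𝓡∂ 4) (𝓡 4) ∞ f₂ ∧
      range f₁ ∪ range f₂ = univ ∧ range f₁ ∩ range f₂ = f₁ '' (𝓡∂ 4).boundary V₁ ∧
      range f₁ ∩ range f₂ = f₂ '' (𝓡∂ 4).boundary V₂ ∧
      (∀ v₁ v₂, f₁ v₁ = f₂ v₂ →
        Submodule.map (mfderiv (𝓡∂ 4) (𝓡 4) f₁ v₁).toLinearMap (contactPlane K₁.J v₁) =
        Submodule.map (mfderiv (𝓡∂ 4) (𝓡 4) f₂ v₂).toLinearMap (contactPlane K₂.J v₂)) ∧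
      PB V₁ n (positiveWord A) ∧ PB V₂ n (positiveWord B)

/-- Shape of reader 1 (`χ`: a ℚ-acyclic `X(P_n; w)` has `n` letters), over `PB`; for the thin
vocabulary this is `planarLefschetzBody_length_of_acyclic` verbatim (refuted for that reading).
[cite: GompfStipsiczGSM1999, §8.1 and §8.2] -/
def ShapeLength : Prop :=
  ∀ (X : Type) [TopologicalSpace X] [T2Space X] [SecondCountableTopology X]
    [ChartedSpace (EuclideanHalfSpace 4) X] [IsManifold (𝓡∂ 4) ∞ X] [CompactSpace X]
    (n : ℕ) (w : List Letter), PB X n w →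
    (∀ k, 0 < k → IsZero (singularHomology ℚ ℚ X k)) → w.length = n

/-- Shape of reader 2 (`H₁(X(P_n; w); ℤ) = 0` ⇒ unimodular hole matrix), over `PB`; for the thin
vocabulary this is `planarLefschetzBody_unimodular_of_isZero_H1` verbatim (refuted for that reading).
[cite: GompfStipsiczGSM1999, §8.2 p. 292] -/
def ShapeUnimodular : Prop :=
  ∀ (X : Type) [TopologicalSpace X] [T2Space X] [SecondCountableTopology X]
    [ChartedSpace (EuclideanHalfSpace 4) X] [IsManifold (𝓡∂ 4) ∞ X] [CompactSpace X]
    (n : ℕ) (w : List Letter), PB X n w →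
    IsZero (singularHomology ℤ ℤ X 1) → Unimodular n (w.map Prod.fst)

/-- Shape of reader 3 (`π₁(X̂(P_n; w)) = 1` ⇒ curves normally generate `F_n`), over `PW`; for the
thin vocabulary this is `planarWordManifold_normallyGenerates_of_simplyConnected` verbatim (refuted for
that reading). [cite: GompfStipsiczGSM1999, §8.2 p. 292] -/
def ShapeNG : Prop :=
  ∀ (M : Type) [TopologicalSpace M] [T2Space M] [SecondCountableTopology M] [ChartedSpace (EuclideanSpace ℝ (Fin 4)) M]
    [IsManifold (𝓡 4) ∞ M] (n : ℕ) (w : List Letter), PW M n w →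
    SimplyConnectedSpace M → NormallyGenerates n (w.map Prod.fst)

/-- Shape of reader 4 (`n` letters normally generating ⇒ `X(P_n; w)` contractible), over `PB`; for
the thin vocabulary this is `planarLefschetzBody_contractible` verbatim.
[cite: Hatcher2002, Thm. 4.5 and Cor. 4.33] -/
def ShapeContractible : Prop :=
  ∀ (X : Type) [TopologicalSpace X] [T2Space X] [SecondCountableTopology X]
    [ChartedSpace (EuclideanHalfSpace 4) X] [IsManifold (𝓡∂ 4) ∞ X] [CompactSpace X]
    (n : ℕ) (w : List Letter), PB X n w →
    NormallyGenerates n (w.map Prod.fst) → w.length = n → ContractibleSpace X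

/-- Shape of reader 5 (`X(P_n; w)` with `n` letters and simply connected double is contractible),
over `PB`; for the thin vocabulary this is `planarLefschetzBody_contractible_of_isDouble` verbatim.
[cite: GompfStipsiczGSM1999, §8.2 p. 292] -/
def ShapeContractibleDouble : Prop :=
  ∀ (X : Type) [TopologicalSpace X] [T2Space X] [SecondCountableTopology X]
    [ChartedSpace (EuclideanHalfSpace 4) X] [IsManifold (𝓡∂ 4) ∞ X] [CompactSpace X]
    (n : ℕ) (w : List Letter) (b : BoundaryData (𝓡∂ 4) X (𝓡 3))
    (M : Type) [TopologicalSpace M] [T2Space M] [SecondCountableTopology M] [ChartedSpace (EuclideanSpace ℝ (Fin 4)) M]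
    [IsManifold (𝓡 4) ∞ M], PB X n w → w.length = n → IsDouble b (𝓡 4) M →
    SimplyConnectedSpace M → ContractibleSpace X

/-- Shape F-M (the five moves re-read the same closed manifold), over `PW`; for the thin vocabulary
this is `planarWordManifold_move_iff` verbatim. [cite: GompfStipsiczGSM1999, §8.2 and §8.4] -/
def ShapeMoveIff : Prop :=
  ∀ (M : Type) [TopologicalSpace M] [T2Space M] [SecondCountableTopology M] [ChartedSpace (EuclideanSpace ℝ (Fin 4)) M]
    [IsManifold (𝓡 4) ∞ M] (s t : ℕ × List Letter), Move s t → (PW M s.1 s.2 ↔ PW M t.1 t.2)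

/-- Shape F-D (a block form with letterwise equal twists presents a double), over `(PB, PW)`; for
the thin vocabulary this is `planarWordManifold_isDouble_of_twistEq` verbatim.
[cite: Baykur2006, §5] -/
def ShapeDoubleOfTwistEq : Prop :=
  ∀ (M : Type) [TopologicalSpace M] [T2Space M] [SecondCountableTopology M] [ChartedSpace (EuclideanSpace ℝ (Fin 4)) M]
    [IsManifold (𝓡 4) ∞ M] (n : ℕ) (A B : List PlanarCurve), (∀ c ∈ A ++ B, c.a ≤ c.b ∧ c.b < n) →
    TwistEq n A B → PW M n (blockForm A B) →
    ∃ (X : Type) (_ : TopologicalSpace X) (_ : T2Space X) (_ : SecondCountableTopology X)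
      (_ : ChartedSpace (EuclideanHalfSpace 4) X) (_ : IsManifold (𝓡∂ 4) ∞ X) (_ : CompactSpace X)
      (b : BoundaryData (𝓡∂ 4) X (𝓡 3)),
      PB X n (positiveWord A) ∧ IsDouble b (𝓡 4) M

/-! ### The shapes ARE the landed facts for the thin reading (definitional) -/

/-- The thin reading of bodies (`PlanarLefschetzBody.lean`). [folklore] -/
abbrev thinBody : BodyReading := fun X _ _ n w => IsPlanarLefschetzBody X n w

/-- The thin reading of closed models (`PlanarLefschetzBody.lean`). [folklore] -/
abbrev thinWord : WordReading := fun M _ _ n w => IsPlanarWordManifold M n w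

example : ShapeWendl thinBody thinWord ↔ wendl_planarSteinBisection := Iff.rfl
example : ShapeSteinSupported thinBody ↔ planarLefschetzBody_stein_supported := Iff.rfl
example : ShapeBaykur thinBody thinWord ↔ baykur_planarSteinBisection := Iff.rfl
example : ShapeLength thinBody ↔ planarLefschetzBody_length_of_acyclic := Iff.rfl
example : ShapeUnimodular thinBody ↔ planarLefschetzBody_unimodular_of_isZero_H1 := Iff.rfl
example : ShapeNG thinWord ↔ planarWordManifold_normallyGenerates_of_simplyConnected := Iff.rfl
example : ShapeContractible thinBody ↔ planarLefschetzBody_contractible := Iff.rfl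
example : ShapeContractibleDouble thinBody ↔ planarLefschetzBody_contractible_of_isDouble := Iff.rfl
example : ShapeMoveIff thinWord ↔ planarWordManifold_move_iff := Iff.rfl
example : ShapeDoubleOfTwistEq thinBody thinWord ↔ planarWordManifold_isDouble_of_twistEq := Iff.rfl

/-- For the THIN reading three shapes fail (the tree's counterexample file), so §2 cannot be fed
with it. [folklore] -/
theorem thin_shapes_fail :
    ¬ ShapeLength thinBody ∧ ¬ ShapeUnimodular thinBody ∧ ¬ ShapeNG thinWord :=
  ⟨Literature.Topology.FourManifolds.not_planarLefschetzBody_length_of_acyclic,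
    Literature.Topology.FourManifolds.not_planarLefschetzBody_unimodular_of_isZero_H1,
    Literature.Topology.FourManifolds.not_planarWordManifold_normallyGenerates_of_simplyConnected⟩

variable {PB PW}

/-! ### The derivation (c3's proofs, predicates abstracted) -/

/-- The curves of a positive word (bookkeeping). [folklore] -/
theorem map_fst_positiveWord (A : List PlanarCurve) : (positiveWord A).map Prod.fst = A := by
  induction A with
  | nil => rfl
  | cons c A ih => exact congrArg (List.cons c) ih

/-- The positive letters of a block form are the letters of its first block. [folklore] -/
theorem mem_blockForm_left {A B : List PlanarCurve} {c : PlanarCurve} (hc : c ∈ A) :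
    (c, true) ∈ blockForm A B :=
  List.mem_append.2 (Or.inl (List.mem_map.2 ⟨c, hc, rfl⟩))

/-- The negative letters of a block form are the letters of its second block. [folklore] -/
theorem mem_blockForm_right {A B : List PlanarCurve} {c : PlanarCurve} (hc : c ∈ B) :
    (c, false) ∈ blockForm A B :=
  List.mem_append.2 (Or.inr (List.mem_reverse.2 (List.mem_map.2 ⟨c, hc, rfl⟩)))

/-- Along the orbit of an integral homotopy-sphere word, every curve of every reachable block form
encloses a nonempty in-page block (`holes_of_reachable`, p115709, read on the two blocks).
[folklore] -/
theorem holes_of_reachable_blockForm {n n' : ℕ} {A B A' B' : List PlanarCurve}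
    (hw : IsIntegralSphereWord n A B) (hr : Reachable (n, blockForm A B) (n', blockForm A' B')) :
    ∀ c ∈ A' ++ B', c.a ≤ c.b ∧ c.b < n' := by
  intro c hc
  rcases List.mem_append.1 hc with hA | hB
  · exact holes_of_reachable hw hr (c, true) (mem_blockForm_left hA)
  · exact holes_of_reachable hw hr (c, false) (mem_blockForm_right hB)

/-- **The moves re-read the same closed manifold, along the whole orbit**: `Reachable` is the
equivalence closure of `Move`, and each move is an `iff` for the reading by shape F-M. [folklore] -/
theorem reading_of_reachable (hM : ShapeMoveIff PW)
    (M : Type) [TopologicalSpace M] [T2Space M] [SecondCountableTopology M] [ChartedSpace E4 M]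
    [IsManifold (𝓡 4) ∞ M] {s t : ℕ × List Letter} (hr : Reachable s t)
    (hs : PW M s.1 s.2) : PW M t.1 t.2 := by
  induction hr with
  | refl => exact hs
  | tail _ hst ih =>
    rcases hst with h | h
    · exact (hM M _ _ h).1 ih
    · exact (hM M _ _ h).2 ih

/-- **A homotopy 4-sphere is simply connected** (`S⁴` is, PROVED in tree; transport along `≃ₕ`).
[folklore] -/
theorem simplyConnected_of_homotopyEquiv_sphere (M : Type) [TopologicalSpace M] (hM : M ≃ₕ 𝕊⁴) :
    SimplyConnectedSpace M :=
  haveI : SimplyConnectedSpace 𝕊⁴ := simplyConnectedSpace_euclideanSphere (n := 4) (by norm_num)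
  hM.simplyConnectedSpace

/-- **THE READ** from F-a, shape F-WB and the three readers, over any reading: under the crux
hypotheses, unbundled, with the planar supporting open book `ob` of `(∂W₁, ξ₁)` explicit, there is
a homotopy-sphere word `(n; A, B)` with the `H₁`-reader, and `M` reads as the word manifold of the
block form `A · B̄ʳᵉᵛ`. [folklore] -/
theorem dictionary_read (hFa : supportedPlanarMonodromy) (hW : ShapeWendl PB PW)
    (hRlen : ShapeLength PB) (hRuni : ShapeUnimodular PB) (hRng : ShapeNG PW)
    (M : Type) [TopologicalSpace M] [T2Space M] [SecondCountableTopology M] [ChartedSpace E4 M]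
    [IsManifold (𝓡 4) ∞ M] (hM : M ≃ₕ 𝕊⁴)
    (W₁ : Type) [TopologicalSpace W₁] [ChartedSpace (EuclideanHalfSpace 4) W₁] [IsManifold (𝓡∂ 4) ∞ W₁]
    [CompactSpace W₁] (W₂ : Type) [TopologicalSpace W₂] [ChartedSpace (EuclideanHalfSpace 4) W₂]
    [IsManifold (𝓡∂ 4) ∞ W₂] [CompactSpace W₂] (J₁ : SteinStructure W₁) (J₂ : SteinStructure W₂)
    (e₁ : W₁ → M) (e₂ : W₂ → M)
    (he₁ : Manifold.IsSmoothEmbedding (𝓡∂ 4) (𝓡 4) ∞ e₁)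
    (he₂ : Manifold.IsSmoothEmbedding (𝓡∂ 4) (𝓡 4) ∞ e₂)
    (hcover : range e₁ ∪ range e₂ = univ)
    (hseam₁ : range e₁ ∩ range e₂ = e₁ '' (𝓡∂ 4).boundary W₁)
    (hseam₂ : range e₁ ∩ range e₂ = e₂ '' (𝓡∂ 4).boundary W₂)
    (hξ : ∀ w₁ w₂, e₁ w₁ = e₂ w₂ →
      Submodule.map (mfderiv (𝓡∂ 4) (𝓡 4) e₁ w₁).toLinearMap (contactPlane J₁.J w₁) =
      Submodule.map (mfderiv (𝓡∂ 4) (𝓡 4) e₂ w₂).toLinearMap (contactPlane J₂.J w₂))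
    (hac : ∀ k, 0 < k → IsZero (singularHomology ℚ ℚ W₁ k) ∧ IsZero (singularHomology ℚ ℚ W₂ k))
    (b₁ : BoundaryData (𝓡∂ 4) W₁ (𝓡 3)) (ob : OpenBook b₁.carrier) (hpl : ob.IsPlanar)
    (hsupp : ob.Supports (boundaryPlaneField J₁.J b₁)) :
    ∃ (n : ℕ) (A B : List PlanarCurve),
      (∀ c ∈ A ++ B, c.InRange n) ∧ A.length = n ∧ B.length = n ∧
      monodromy n (positiveWord A) = monodromy n (positiveWord B) ∧ NormallyGenerates n (A ++ B) ∧
      (IsZero (singularHomology ℤ ℤ W₁ 1) → Unimodular n A) ∧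
      PW M n (blockForm A B) := by
  -- point-set preliminaries: the halves are Hausdorff and second countable (embedded in `M`)
  haveI : T2Space W₁ := he₁.isEmbedding.t2Space
  haveI : T2Space W₂ := he₂.isEmbedding.t2Space
  haveI : SecondCountableTopology W₁ := he₁.isEmbedding.secondCountableTopology
  haveI : SecondCountableTopology W₂ := he₂.isEmbedding.secondCountableTopology
  -- the seam model is a connected closed 3-manifold
  haveI : T2Space b₁.carrier := b₁.isSmoothEmbedding.isEmbedding.t2Space
  haveI : CompactSpace b₁.carrier := b₁.compactSpace_carrier
  haveI : ConnectedSpace b₁.carrier :=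
    (Theorems.PlanarAcyclicBisectionRigidity.Sketch.helper_connected_seam M hM W₁ W₂ J₁ J₂ e₁ e₂ he₁
      he₂ hcover hseam₁ hseam₂ b₁).2.2
  -- F-a: a positively framed planar monodromy chart for the supporting open book
  obtain ⟨α, hGiroux⟩ := hsupp
  obtain ⟨K', n, φ, -, -, hGiroux', hframed, hmono⟩ :=
    hFa b₁.carrier ob (boundaryPlaneField J₁.J b₁) α hpl hGiroux
  -- Wendl, both halves, closed up
  obtain ⟨A, B, hin, hmonA, hmonB, hbody₁, hbody₂, hword⟩ :=
    hW M W₁ W₂ J₁ J₂ e₁ e₂ he₁ he₂ hcover hseam₁ hseam₂ hξ b₁ K' α n φ hGiroux' hframed hmono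
  refine ⟨n, A, B, hin, ?_, ?_, hmonA.trans hmonB.symm, ?_, ?_, hword⟩
  · -- lengths from ℚ-acyclicity
    simpa [positiveWord] using hRlen W₁ n (positiveWord A) hbody₁ (fun k hk => (hac k hk).1)
  · simpa [positiveWord] using hRlen W₂ n (positiveWord B) hbody₂ (fun k hk => (hac k hk).2)
  · -- `π₁(M) = 1` ⇒ the curves normally generate `F_n`
    have hsc : SimplyConnectedSpace M := simplyConnected_of_homotopyEquiv_sphere M hM
    have h := hRng M n (blockForm A B) hword hsc
    -- the curves of the block form are those of `A ++ B` (up to order)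
    unfold NormallyGenerates at h ⊢
    rw [← h]
    congr 1
    ext x
    simp [blockForm, positiveWord, List.mem_map, List.mem_reverse, List.mem_append]
  · -- `H₁(W₁; ℤ) = 0` ⇒ the hole matrix of `A` is unimodular
    intro hint
    have h := hRuni W₁ n (positiveWord A) hbody₁ hint
    rwa [map_fst_positiveWord] at h

/-- **WRITE-BACK (ii), the DOUBLE exit**, from shapes F-M, F-D, F-c and reader 5, over any reading:
if `M` reads as the word manifold of a homotopy-sphere word `(n; A, B)` (integral, so that the orbit
invariants apply) and the walk reaches a block form `(n′; A′, B′)` with letterwise equal twists, then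
`M` is the double `D(X)` of a CONTRACTIBLE compact Stein domain whose boundary complex tangencies are
supported by a planar open book with `n′ + 1` binding components. [folklore] -/
theorem dictionary_double (hMv : ShapeMoveIff PW) (hD : ShapeDoubleOfTwistEq PB PW)
    (hLP : ShapeSteinSupported PB) (hRcd : ShapeContractibleDouble PB)
    (M : Type) [TopologicalSpace M] [T2Space M] [SecondCountableTopology M] [ChartedSpace E4 M]
    [IsManifold (𝓡 4) ∞ M] (hM : M ≃ₕ 𝕊⁴) (n : ℕ) (A B : List PlanarCurve)
    (hw : IsIntegralSphereWord n A B) (hword : PW M n (blockForm A B))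
    (n' : ℕ) (A' B' : List PlanarCurve) (hr : Reachable (n, blockForm A B) (n', blockForm A' B'))
    (hte : TwistEq n' A' B') :
    ∃ (W : Type) (_ : TopologicalSpace W) (_ : T2Space W) (_ : SecondCountableTopology W)
      (_ : ChartedSpace (EuclideanHalfSpace 4) W) (_ : IsManifold (𝓡∂ 4) ∞ W) (_ : CompactSpace W)
      (_ : ContractibleSpace W) (J : SteinStructure W) (b : BoundaryData (𝓡∂ 4) W (𝓡 3))
      (ob' : OpenBook b.carrier),
      ob'.IsPlanar ∧ ob'.k = n' + 1 ∧ ob'.Supports (boundaryPlaneField J.J b) ∧ IsDouble b (𝓡 4) M := by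
  -- the reading at the reached state
  have hword' : PW M n' (blockForm A' B') := reading_of_reachable hMv M hr hword
  -- every reached curve encloses a nonempty in-page block
  have hholes : ∀ c ∈ A' ++ B', c.a ≤ c.b ∧ c.b < n' := holes_of_reachable_blockForm hw hr
  -- the double
  obtain ⟨X, τ, η₂, σ₂, χ, μ, κ, b, hbody, hdouble⟩ := hD M n' A' B' hholes hte hword'
  -- Stein structure with supporting planar open book on `b`
  obtain ⟨S, ob', hpl', hk', hsupp'⟩ :=
    hLP X n' A' (fun c hc => hholes c (List.mem_append.2 (Or.inl hc))) hbody b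
  -- contractibility
  have hlen : (positiveWord A').length = n' := by
    simpa [positiveWord] using (length_of_reachable hw hr).1
  have hcX : ContractibleSpace X :=
    hRcd X n' (positiveWord A') b M hbody hlen hdouble (simplyConnected_of_homotopyEquiv_sphere M hM)
  exact ⟨X, τ, η₂, σ₂, χ, μ, κ, hcX, S, b, ob', hpl', hk', hsupp', hdouble⟩

/-- **WRITE-BACK (iv), the SIMPLY-CONNECTED-BLOCKS exit**, from shapes F-M, F-S and reader 4, over
any reading: if `M` reads as the word manifold of an integral homotopy-sphere word `(n; A, B)` and
the walk reaches a block form `(n′; A′, B′)` both of whose blocks have curves normally generating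
`F_{n′}`, then `M` re-bisects along a common contact seam into two CONTRACTIBLE compact Stein
domains. [folklore] -/
theorem dictionary_sc (hMv : ShapeMoveIff PW) (hBay : ShapeBaykur PB PW)
    (hRc : ShapeContractible PB)
    (M : Type) [TopologicalSpace M] [T2Space M] [SecondCountableTopology M] [ChartedSpace E4 M]
    [IsManifold (𝓡 4) ∞ M] (n : ℕ) (A B : List PlanarCurve)
    (hw : IsIntegralSphereWord n A B) (hword : PW M n (blockForm A B))
    (n' : ℕ) (A' B' : List PlanarCurve) (hr : Reachable (n, blockForm A B) (n', blockForm A' B'))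
    (hsc : NormallyGenerates n' A' ∧ NormallyGenerates n' B') :
    ∃ (V₁ : Type) (_ : TopologicalSpace V₁) (_ : ChartedSpace (EuclideanHalfSpace 4) V₁)
      (_ : IsManifold (𝓡∂ 4) ∞ V₁) (_ : CompactSpace V₁) (_ : ContractibleSpace V₁)
      (V₂ : Type) (_ : TopologicalSpace V₂) (_ : ChartedSpace (EuclideanHalfSpace 4) V₂)
      (_ : IsManifold (𝓡∂ 4) ∞ V₂) (_ : CompactSpace V₂) (_ : ContractibleSpace V₂)
      (K₁ : SteinStructure V₁) (K₂ : SteinStructure V₂) (f₁ : V₁ → M) (f₂ : V₂ → M),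
      Manifold.IsSmoothEmbedding (𝓡∂ 4) (𝓡 4) ∞ f₁ ∧ Manifold.IsSmoothEmbedding (𝓡∂ 4) (𝓡 4) ∞ f₂ ∧
      range f₁ ∪ range f₂ = univ ∧ range f₁ ∩ range f₂ = f₁ '' (𝓡∂ 4).boundary V₁ ∧
      range f₁ ∩ range f₂ = f₂ '' (𝓡∂ 4).boundary V₂ ∧
      (∀ v₁ v₂, f₁ v₁ = f₂ v₂ →
        Submodule.map (mfderiv (𝓡∂ 4) (𝓡 4) f₁ v₁).toLinearMap (contactPlane K₁.J v₁) =
        Submodule.map (mfderiv (𝓡∂ 4) (𝓡 4) f₂ v₂).toLinearMap (contactPlane K₂.J v₂)) := by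
  have hword' : PW M n' (blockForm A' B') := reading_of_reachable hMv M hr hword
  have hholes : ∀ c ∈ A' ++ B', c.a ≤ c.b ∧ c.b < n' := holes_of_reachable_blockForm hw hr
  have hmon' : monodromy n' (positiveWord A') = monodromy n' (positiveWord B') :=
    Theorems.PlanarAcyclicBisectionRigidity.Sketch.helper_reachable_monodromy_eq n n' A B A' B' hw hr
  obtain ⟨V₁, τ₁, χ₁, μ₁, κ₁, V₂, τ₂, χ₂, μ₂, κ₂, K₁, K₂, f₁, f₂, hf₁, hf₂, hcov, hs₁, hs₂, hξ', hb₁,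
    hb₂⟩ := hBay M n' A' B' hholes hmon' hword'
  haveI : T2Space V₁ := hf₁.isEmbedding.t2Space
  haveI : T2Space V₂ := hf₂.isEmbedding.t2Space
  haveI : SecondCountableTopology V₁ := hf₁.isEmbedding.secondCountableTopology
  haveI : SecondCountableTopology V₂ := hf₂.isEmbedding.secondCountableTopology
  have hlen := length_of_reachable hw hr
  have hngA : NormallyGenerates n' ((positiveWord A').map Prod.fst) := by
    rw [map_fst_positiveWord]; exact hsc.1
  have hngB : NormallyGenerates n' ((positiveWord B').map Prod.fst) := by
    rw [map_fst_positiveWord]; exact hsc.2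
  have hlenA : (positiveWord A').length = n' := by simpa [positiveWord] using hlen.1
  have hlenB : (positiveWord B').length = n' := by simpa [positiveWord] using hlen.2
  have hc₁ : ContractibleSpace V₁ := hRc V₁ n' (positiveWord A') hb₁ hngA hlenA
  have hc₂ : ContractibleSpace V₂ := hRc V₂ n' (positiveWord B') hb₂ hngB hlenB
  exact ⟨V₁, τ₁, χ₁, μ₁, κ₁, hc₁, V₂, τ₂, χ₂, μ₂, κ₂, hc₂, K₁, K₂, f₁, f₂, hf₁, hf₂, hcov, hs₁, hs₂, hξ'⟩

/-- **THE ELEVEN ITEMISED FACT SHAPES, OVER ANY READING, GIVE THE DICTIONARY BY USE.**  So an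
honest reading `(PB, PW)` (a repaired `X(P; w)` vocabulary) with its eleven `_holds` closes Stub 1:
`exact dictionary_of_facts hFa hW hLP hBay hRlen hRuni hRng hRc hRcd hMv hD`. [folklore] -/
theorem dictionary_of_facts (hFa : supportedPlanarMonodromy) (hW : ShapeWendl PB PW)
    (hLP : ShapeSteinSupported PB) (hBay : ShapeBaykur PB PW) (hRlen : ShapeLength PB)
    (hRuni : ShapeUnimodular PB) (hRng : ShapeNG PW) (hRc : ShapeContractible PB)
    (hRcd : ShapeContractibleDouble PB) (hMv : ShapeMoveIff PW) (hD : ShapeDoubleOfTwistEq PB PW) :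
    DictionaryByUse := by
  intro M _ _ _ _ _ hM W₁ _ _ _ _ W₂ _ _ _ _ J₁ J₂ e₁ e₂ he₁ he₂ hcover hseam₁ hseam₂ hξ hac hplanar
  obtain ⟨b₁, ob, hobpl, hobsupp⟩ := id hplanar
  obtain ⟨n, A, B, hin, hA, hB, hmonAB, hng, hreader, hword⟩ :=
    dictionary_read hFa hW hRlen hRuni hRng M hM W₁ W₂ J₁ J₂ e₁ e₂ he₁ he₂ hcover hseam₁ hseam₂ hξ
      hac b₁ ob hobpl hobsupp
  refine ⟨n, A, B, hin, hA, hB, hmonAB, hng, hreader, fun n' A' B' hw hr => ⟨fun hte => ?_, fun hS => ?_⟩⟩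
  · exact dictionary_double hMv hD hLP hRcd M hM n A B hw hword n' A' B' hr hte
  · exact dictionary_sc hMv hBay hRc M n A B hw hword n' A' B' hr hS

end Derivation

/-! ## §3  Cross-links for the absorbing targets (sorry-free) -/

/-- **Crux 4 absorbs every common-contact Stein bisection with contractible halves** — the
re-bisections written back by the SC exit of Stub 1.  `M` is compact as the union of the two compact
embedded images. [folklore] -/
theorem contractibleHalves_absorb (h4 : ConvexBisection.ContractibleTwistedDoubleStandard)
    (M : Type) [TopologicalSpace M] [T2Space M] [SecondCountableTopology M] [ChartedSpace E4 M]
    [IsManifold (𝓡 4) ∞ M]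
    (V₁ : Type) [TopologicalSpace V₁] [ChartedSpace (EuclideanHalfSpace 4) V₁] [IsManifold (𝓡∂ 4) ∞ V₁]
    [CompactSpace V₁] [ContractibleSpace V₁]
    (V₂ : Type) [TopologicalSpace V₂] [ChartedSpace (EuclideanHalfSpace 4) V₂] [IsManifold (𝓡∂ 4) ∞ V₂]
    [CompactSpace V₂] [ContractibleSpace V₂]
    (K₁ : SteinStructure V₁) (K₂ : SteinStructure V₂) (f₁ : V₁ → M) (f₂ : V₂ → M)
    (hf₁ : Manifold.IsSmoothEmbedding (𝓡∂ 4) (𝓡 4) ∞ f₁)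
    (hf₂ : Manifold.IsSmoothEmbedding (𝓡∂ 4) (𝓡 4) ∞ f₂)
    (hcover : range f₁ ∪ range f₂ = univ)
    (hseam₁ : range f₁ ∩ range f₂ = f₁ '' (𝓡∂ 4).boundary V₁)
    (hseam₂ : range f₁ ∩ range f₂ = f₂ '' (𝓡∂ 4).boundary V₂)
    (hξ : ∀ v₁ v₂, f₁ v₁ = f₂ v₂ →
      Submodule.map (mfderiv (𝓡∂ 4) (𝓡 4) f₁ v₁).toLinearMap (contactPlane K₁.J v₁) =
      Submodule.map (mfderiv (𝓡∂ 4) (𝓡 4) f₂ v₂).toLinearMap (contactPlane K₂.J v₂)) :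
    Nonempty (M ≃ₘ⟮𝓡 4, 𝓡 4⟯ 𝕊⁴) := by
  haveI : CompactSpace M := isCompact_univ_iff.mp (hcover ▸
    ((isCompact_range hf₁.isEmbedding.continuous).union
      (isCompact_range hf₂.isEmbedding.continuous)))
  exact h4 M V₁ V₂ K₁ K₂ f₁ f₂ hf₁ hf₂ hcover hseam₁ hseam₂ hξ

/-- **Honest doubles at levels `n′ ≠ 3` are absorbed by crux 4**, through the landed
`Negative.DoubleBisection.double_standard_of_crux`. [folklore] -/
theorem planarSteinDouble_of_crux4 (h4 : ConvexBisection.ContractibleTwistedDoubleStandard)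
    (M : Type) [TopologicalSpace M] [T2Space M] [SecondCountableTopology M] [ChartedSpace E4 M]
    [IsManifold (𝓡 4) ∞ M]
    (W : Type) [TopologicalSpace W] [T2Space W] [SecondCountableTopology W]
    [ChartedSpace (EuclideanHalfSpace 4) W] [IsManifold (𝓡∂ 4) ∞ W] [CompactSpace W]
    [ContractibleSpace W] (J : SteinStructure W) (b : BoundaryData (𝓡∂ 4) W (𝓡 3))
    (hdouble : IsDouble b (𝓡 4) M) :
    Nonempty (M ≃ₘ⟮𝓡 4, 𝓡 4⟯ 𝕊⁴) :=
  Theorems.ContractibleTwistedDoubleStandard.Negative.double_standard_of_crux h4 W J b M hdouble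

/-- **The double exit, dispatched by level**: an honest double written back at level `n′` is `S⁴` —
by Oba + Mazur when the supporting open book has `n′ + 1 = 4` binding components (NO open problem),
by crux 4 otherwise. [folklore] -/
theorem double_exit_standard (hO : Oba2016_steinFilling_fourHoledSphere) (n' : ℕ)
    (h4 : n' ≠ 3 → ConvexBisection.ContractibleTwistedDoubleStandard)
    (M : Type) [TopologicalSpace M] [T2Space M] [SecondCountableTopology M] [ChartedSpace E4 M]
    [IsManifold (𝓡 4) ∞ M]
    (W : Type) [TopologicalSpace W] [T2Space W] [SecondCountableTopology W]
    [ChartedSpace (EuclideanHalfSpace 4) W] [IsManifold (𝓡∂ 4) ∞ W] [CompactSpace W]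
    [ContractibleSpace W] (J : SteinStructure W) (b : BoundaryData (𝓡∂ 4) W (𝓡 3))
    (ob : OpenBook b.carrier) (hpl : ob.IsPlanar) (hk : ob.k = n' + 1)
    (hsupp : ob.Supports (boundaryPlaneField J.J b)) (hdouble : IsDouble b (𝓡 4) M) :
    Nonempty (M ≃ₘ⟮𝓡 4, 𝓡 4⟯ 𝕊⁴) := by
  by_cases hn : n' = 3
  · subst hn
    exact helper_obaMazur_double_standard hO W J b ob hpl hk hsupp M hdouble
  · exact planarSteinDouble_of_crux4 (h4 hn) M W J b hdouble

/-! ## §4  The composition (kernel-checked, no `sorry` of its own) -/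

/-- **The walk for every integral homotopy-sphere word with `n ≤ 3` letters exits with an honest
double AT LEVEL 3**: `n ≤ 2` by `helper_walkLow_level3` (landed), `n = 3` by `stub_walk3` (landed). -/
theorem walk_le3 (n : ℕ) (A B : List PlanarCurve) (hw : IsIntegralSphereWord n A B) (hn : n ≤ 3) :
    ∃ (A' B' : List PlanarCurve),
      Reachable (n, blockForm A B) (3, blockForm A' B') ∧ TwistEq 3 A' B' := by
  rcases Nat.lt_or_ge n 3 with h | h
  · exact helper_walkLow_level3 n A B hw (by omega)
  · obtain rfl : n = 3 := le_antisymm hn h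
    exact stub_walk3 A B hw

/-- **The stubs prove the crux `ConvexBisection.PlanarAcyclicBisectionRigidity` BY NAME.**
READ (`stub_dictionary`) the bisection as a homotopy-sphere word `(n; A, B)` together with its
write-backs along the orbit.  Case `n ≤ 3`: integral automatically (Hantzsche at word level),
level-3 walk (`walk_le3`), DOUBLE write-back at level `3`, Oba + Mazur — no route item, no
conjecture.  Case `n ≥ 4`: INTEGRAL (`H₁(W₁;ℤ) = 0`: reader + Gram transfer) → REACH-SC → honest
double (write-back (ii) → `double_exit_standard`) or two simply connected blocks (write-back (iv) →
crux 4); TORSION → `stub_torsionSector`. -/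
theorem PlanarAcyclicBisectionRigidity_of : ConvexBisection.PlanarAcyclicBisectionRigidity := by
  intro M _ _ _ _ _ hM hb
  obtain ⟨W₁, _, _, _, _, W₂, _, _, _, _, J₁, J₂, e₁, e₂, he₁, he₂, hcover, hseam₁, hseam₂, hξ, hac,
    hpl⟩ := hb
  obtain ⟨n, A, B, hin, hA, hB, hmonAB, hng, hreader, hwrite⟩ :=
    stub_dictionary M hM W₁ W₂ J₁ J₂ e₁ e₂ he₁ he₂ hcover hseam₁ hseam₂ hξ hac hpl
  rcases Nat.lt_or_ge n 4 with hn | hn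
  · -- `k ≤ 4`: no open problem and no integral hypothesis on this path
    obtain ⟨huA, huB⟩ := helper_unimodular_of_sphereWord_le3 n (by omega) A B hin hA hB hmonAB hng
    have hw : IsIntegralSphereWord n A B := ⟨hin, hA, hB, hmonAB, hng, huA, huB⟩
    obtain ⟨A', B', hreach, hte⟩ := walk_le3 n A B hw (by omega)
    obtain ⟨W, _, _, _, _, _, _, _, J, b, ob', hpl', hk', hsupp', hdouble⟩ :=
      (hwrite 3 A' B' hw hreach).1 hte
    exact helper_obaMazur_double_standard stub_factOba W J b ob' hpl' hk' hsupp' M hdouble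
  by_cases hint : IsZero (singularHomology ℤ ℤ W₁ 1)
  · have huA : Unimodular n A := hreader hint
    have huB : Unimodular n B := unimodular_transfer n A B hin hA hB hmonAB huA
    have hw : IsIntegralSphereWord n A B := ⟨hin, hA, hB, hmonAB, hng, huA, huB⟩
    obtain ⟨n', A', B', hreach, htarget⟩ := stub_walkHighSC n A B hw hn
    rcases htarget with hte | hS
    · obtain ⟨W, _, _, _, _, _, _, _, J, b, ob', hpl', hk', hsupp', hdouble⟩ :=
        (hwrite n' A' B' hw hreach).1 hte
      exact double_exit_standard stub_factOba n' (fun _ => stub_contractibleStandard) M W J b ob'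
        hpl' hk' hsupp' hdouble
    · obtain ⟨V₁, _, _, _, _, _, V₂, _, _, _, _, _, K₁, K₂, f₁, f₂, hf₁, hf₂, hcov', hs₁', hs₂', hξ'⟩ :=
        (hwrite n' A' B' hw hreach).2 hS
      exact contractibleHalves_absorb stub_contractibleStandard M V₁ V₂ K₁ K₂ f₁ f₂ hf₁ hf₂ hcov'
        hs₁' hs₂' hξ'
  · exact stub_torsionSector M hM W₁ W₂ J₁ J₂ e₁ e₂ he₁ he₂ hcover hseam₁ hseam₂ hξ hpl hac hint

/-- **The `k ≤ 4` layer as a stand-alone statement, closed modulo the Oba fact only once the word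
is READ** (planner note of c2, D-0014: displayable as a support item if the route wants it): a
Hausdorff second-countable smooth 4-manifold `M` that Stub 1 reads as a homotopy-sphere word
`(n; A, B)` on `n ≤ 3` holes with the DOUBLE write-back along the orbit is `S⁴` — Hantzsche at word
level (integrality is automatic), the landed level-3 walk, write-back (ii) at level 3, Oba + Mazur.
NO route item and NO conjecture is used. [folklore] -/
theorem standard_of_read_le3 (hO : Oba2016_steinFilling_fourHoledSphere)
    (M : Type) [TopologicalSpace M] [T2Space M] [SecondCountableTopology M] [ChartedSpace E4 M]
    [IsManifold (𝓡 4) ∞ M] (n : ℕ) (hn : n ≤ 3) (A B : List PlanarCurve)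
    (hin : ∀ c ∈ A ++ B, c.InRange n) (hA : A.length = n) (hB : B.length = n)
    (hmonAB : monodromy n (positiveWord A) = monodromy n (positiveWord B))
    (hng : NormallyGenerates n (A ++ B))
    (hwrite : ∀ (n' : ℕ) (A' B' : List PlanarCurve), IsIntegralSphereWord n A B →
      Reachable (n, blockForm A B) (n', blockForm A' B') → TwistEq n' A' B' →
      ∃ (W : Type) (_ : TopologicalSpace W) (_ : T2Space W) (_ : SecondCountableTopology W)
        (_ : ChartedSpace (EuclideanHalfSpace 4) W) (_ : IsManifold (𝓡∂ 4) ∞ W) (_ : CompactSpace W)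
        (_ : ContractibleSpace W) (J : SteinStructure W) (b : BoundaryData (𝓡∂ 4) W (𝓡 3))
        (ob : OpenBook b.carrier),
        ob.IsPlanar ∧ ob.k = n' + 1 ∧ ob.Supports (boundaryPlaneField J.J b) ∧ IsDouble b (𝓡 4) M) :
    Nonempty (M ≃ₘ⟮𝓡 4, 𝓡 4⟯ 𝕊⁴) := by
  obtain ⟨huA, huB⟩ := helper_unimodular_of_sphereWord_le3 n hn A B hin hA hB hmonAB hng
  have hw : IsIntegralSphereWord n A B := ⟨hin, hA, hB, hmonAB, hng, huA, huB⟩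
  obtain ⟨A', B', hreach, hte⟩ := walk_le3 n A B hw hn
  obtain ⟨W, _, _, _, _, _, _, _, J, b, ob', hpl', hk', hsupp', hdouble⟩ :=
    hwrite 3 A' B' hw hreach hte
  exact helper_obaMazur_double_standard hO W J b ob' hpl' hk' hsupp' M hdouble

/-! ## §5  Further cross-links (sorry-free): where Stub 5 sits; symmetry of planarity -/

/-- **Stub 5 is implied by the route's rank-2 crux `AcyclicBisectionRigidity`** (stmt-SmoothPoincare4-10507):
forget planarity and the torsion hypothesis. -/
theorem torsionSector_of_acyclicRigidity (hR : ConvexBisection.AcyclicBisectionRigidity)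
    (M : Type) [TopologicalSpace M] [T2Space M] [SecondCountableTopology M] [ChartedSpace E4 M]
    [IsManifold (𝓡 4) ∞ M] (hM : M ≃ₕ 𝕊⁴)
    (W₁ : Type) [TopologicalSpace W₁] [ChartedSpace (EuclideanHalfSpace 4) W₁] [IsManifold (𝓡∂ 4) ∞ W₁]
    [CompactSpace W₁] (W₂ : Type) [TopologicalSpace W₂] [ChartedSpace (EuclideanHalfSpace 4) W₂]
    [IsManifold (𝓡∂ 4) ∞ W₂] [CompactSpace W₂] (J₁ : SteinStructure W₁) (J₂ : SteinStructure W₂)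
    (e₁ : W₁ → M) (e₂ : W₂ → M)
    (he₁ : Manifold.IsSmoothEmbedding (𝓡∂ 4) (𝓡 4) ∞ e₁)
    (he₂ : Manifold.IsSmoothEmbedding (𝓡∂ 4) (𝓡 4) ∞ e₂)
    (hcover : range e₁ ∪ range e₂ = univ)
    (hseam₁ : range e₁ ∩ range e₂ = e₁ '' (𝓡∂ 4).boundary W₁)
    (hseam₂ : range e₁ ∩ range e₂ = e₂ '' (𝓡∂ 4).boundary W₂)
    (hξ : ∀ w₁ w₂, e₁ w₁ = e₂ w₂ →
      Submodule.map (mfderiv (𝓡∂ 4) (𝓡 4) e₁ w₁).toLinearMap (contactPlane J₁.J w₁) =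
      Submodule.map (mfderiv (𝓡∂ 4) (𝓡 4) e₂ w₂).toLinearMap (contactPlane J₂.J w₂))
    (hplanar : PlanarContactBoundary J₁)
    (hac : ∀ k, 0 < k → IsZero (singularHomology ℚ ℚ W₁ k) ∧ IsZero (singularHomology ℚ ℚ W₂ k))
    (htor : ¬ IsZero (singularHomology ℤ ℤ W₁ 1)) :
    Nonempty (M ≃ₘ⟮𝓡 4, 𝓡 4⟯ 𝕊⁴) :=
  hR M hM ⟨W₁, inferInstance, inferInstance, inferInstance, inferInstance, W₂, inferInstance,
    inferInstance, inferInstance, inferInstance, J₁, J₂, e₁, e₂, he₁, he₂, hcover, hseam₁, hseam₂, hξ, hac⟩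

/-- **Planarity is symmetric in the two halves** (landed p76418): under the bisection hypotheses
`PlanarContactBoundary J₁ → PlanarContactBoundary J₂`. [folklore] -/
theorem planar_symm
    (M : Type) [TopologicalSpace M] [T2Space M] [SecondCountableTopology M] [ChartedSpace E4 M]
    [IsManifold (𝓡 4) ∞ M]
    (W₁ : Type) [TopologicalSpace W₁] [ChartedSpace (EuclideanHalfSpace 4) W₁] [IsManifold (𝓡∂ 4) ∞ W₁]
    [CompactSpace W₁] (W₂ : Type) [TopologicalSpace W₂] [ChartedSpace (EuclideanHalfSpace 4) W₂]
    [IsManifold (𝓡∂ 4) ∞ W₂] [CompactSpace W₂] (J₁ : SteinStructure W₁) (J₂ : SteinStructure W₂)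
    (e₁ : W₁ → M) (e₂ : W₂ → M)
    (he₁ : Manifold.IsSmoothEmbedding (𝓡∂ 4) (𝓡 4) ∞ e₁)
    (he₂ : Manifold.IsSmoothEmbedding (𝓡∂ 4) (𝓡 4) ∞ e₂)
    (hcover : range e₁ ∪ range e₂ = univ)
    (hseam₁ : range e₁ ∩ range e₂ = e₁ '' (𝓡∂ 4).boundary W₁)
    (hseam₂ : range e₁ ∩ range e₂ = e₂ '' (𝓡∂ 4).boundary W₂)
    (hξ : ∀ w₁ w₂, e₁ w₁ = e₂ w₂ →
      Submodule.map (mfderiv (𝓡∂ 4) (𝓡 4) e₁ w₁).toLinearMap (contactPlane J₁.J w₁) =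
      Submodule.map (mfderiv (𝓡∂ 4) (𝓡 4) e₂ w₂).toLinearMap (contactPlane J₂.J w₂))
    (hpl : PlanarContactBoundary J₁) : PlanarContactBoundary J₂ :=
  Theorems.PlanarBisectionRigidity.ColouredStringLinksSquareFreeAc.stub_planarSeamTransfer M W₁ W₂ J₁ J₂
    e₁ e₂ he₁ he₂ hcover hseam₁ hseam₂ hξ hpl

end Summit.SmoothPoincare4.SmoothPoincare4.Cruxes.PlanarAcyclicBisectionRigidity.Sketch

end
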